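import Summits.QuantumFields.YangMills.Theorems.NPointIsotropy.Negative.DegreeTwoFree
import Summits.QuantumFields.YangMills.Theorems.CurvatureBoostCovariance.Negative.BetaZeroTie
import Summits.QuantumFields.YangMills.Theorems.PencilRigidityNPointIsotropyDegreeLeTwo
import Summits.QuantumFields.YangMills.Theorems.PencilRigidityNPointIsotropyRiemannSum
import Summits.QuantumFields.YangMills.Theorems.PencilRigidityNPointIsotropyLatticeOnePoint
import Summits.QuantumFields.YangMills.Theorems.PencilRigidityNPointIsotropyOnePoint
import HarnessLib

/-!
# `NPointIsotropy` — degree 1 of the crux THROUGH THE TIE; degrees `≤ 2` of the crux closed unconditionally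

Support file for crux `stmt-QuantumFields-11686` (`PencilRigidity.NPointIsotropy`), line
`complex-rotation-bandlimit`, generation 5 (lead `prover-line-stmt-QuantumFields-11686-c1-0`): the composition of
the three landed helper stubs of the generation —

* `riemannSumBox` (`PencilRigidityNPointIsotropyRiemannSum`): `a_k⁴ Σ_{y ∈ box 4 L_k} g(a_k y) → ∫ g` along
  `a_k → 0`, `a_k L_k → ∞`;
* `latticeOnePointFactor` (`PencilRigidityNPointIsotropyLatticeOnePoint`): the lattice one-point function of the
  curvature channel is `c_k (μ_k − m_k) · a_k⁴ Σ g(a_k y)` (translation invariance of the torus Wilson state, every β);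
* `onePointConst` (`PencilRigidityNPointIsotropyOnePoint`): hence, through the tie at order 1, `𝔖₁ = κ · dx`;

into statements about a TIED family `S₁` (tied to the curvature channel of Wilson's lattice theory along a scheme):

* `onePoint_of_tie`: `∃ κ, ∀ F, S₁ 1 F = κ ∫ F` on all of `𝓢((Fin 1 → ℝ⁴), ℂ)` — the tie at order 1 is the only input;
* `degreeOne_invariant_of_tie`: `S₁ 1 (R · F) = S₁ 1 F` for EVERY linear isometry `R` of `ℝ⁴` and every `F`;
* `residual_one_of_tie` (`W₁ ≡ κ`), `residual_zero` (E0: `W₀ ≡ 1`), `residual_two` (the radial kernel IS a residual):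
  the function residual of Step 0 in degrees `0, 1, 2`;
* `tie_conclusion_on_tensors_of_beta_zero`: the `β_k = 0`-frequently slice of scheme space is closed — a family tied
  to such a scheme is invariant on off-diagonal real tensors of positive degree under every linear isometry
  (`apply_linActMulti_eq_of_beta_zero` with its one-point hypothesis discharged);
* `cruxDegreesLeTwo` (registered sub-goal): degrees `≤ 2` of the crux's conclusion hold for a tied family with the
  radial two-point kernel under EVERY linear isometry, on `⁰𝒮` — degree 0 trivially, degree 1 by the tie, degree 2 by
  the kernel. No reflection positivity, cone, translations or residual hypothesis enter: the content of the crux is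
  exactly `n ≥ 3`.
[folklore]
-/

noncomputable section

namespace Summit.QuantumFields.YangMills.Theorems.NPointIsotropy.ComplexRotationBandlimit

open scoped SchwartzMap
open MeasureTheory Filter Topology
open Literature.MathematicalPhysics.QuantumLattice Literature.MathematicalPhysics.AQFT
  Literature.MathematicalPhysics.QuantumFieldTheory
open Summit.QuantumFields.YangMills.Theorems.NPointIsotropy.Negative (E4 RadialKernel radialKernel_invariant_two)
open Summit.QuantumFields.YangMills.Theorems.CurvatureBoostCovariance.Negative (Tie apply_linActMulti_eq_of_beta_zero)

section Tied

variable {G : Type} [Group G] [TopologicalSpace G] [IsTopologicalGroup G] [CompactSpace G]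
  [MeasurableSpace G] [BorelSpace G]

/-- **The one-point distribution of a TIED family is `κ · dx`** — for every `G`, `r`, `sch` (any `β_k, c_k, m_k, a_k,
L_k`) and every `S₁` tied to the curvature channel along `sch`: `S₁ 1 F = κ ∫ F` on ALL of `𝓢((Fin 1 → ℝ⁴), ℂ)`. The
tie at order 1 is the only hypothesis: `κ = lim_k c_k (μ_k − m_k)` exists because the tie demands a limit on one
normalised bump, and every other test function follows by the Riemann sums. [folklore] -/
theorem onePoint_of_tie (r : LatticeRep G) (sch : SpeciesScheme (YMSpecies G)) (S₁ : SchwingerFamily E4)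
    (htie : Tie r sch S₁) : ∃ κ : ℂ, ∀ F : 𝓢((Fin 1 → E4), ℂ), S₁ 1 F = κ * ∫ x, F x :=
  onePointConst riemannSumBox G r sch S₁ (fun k => latticeOnePointFactor G r sch k) htie

/-- **Degree 1 of the crux's conclusion through the tie**: for a tied family, `S₁ 1 (R · F) = S₁ 1 F` for EVERY
linear isometry `R` of `ℝ⁴` and every test function `F` (Lebesgue measure on `Fin 1 → ℝ⁴` is invariant under
`x ↦ (R⁻¹ xᵢ)ᵢ`). [folklore] -/
theorem degreeOne_invariant_of_tie (r : LatticeRep G) (sch : SpeciesScheme (YMSpecies G)) (S₁ : SchwingerFamily E4)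
    (htie : Tie r sch S₁) (R : E4 ≃ₗᵢ[ℝ] E4) (F : 𝓢((Fin 1 → E4), ℂ)) : S₁ 1 (linActMulti R F) = S₁ 1 F := by
  obtain ⟨κ, hκ⟩ := onePoint_of_tie r sch S₁ htie
  rw [hκ, hκ]
  congr 1
  have hpt : ∀ x : Fin 1 → E4, (linActMulti R F) x = F (fun i => R.symm (x i)) := fun x => by
    rw [linActMulti_apply]
  simp_rw [hpt]
  exact DegreeLeTwo.integral_comp_isometry_pi 1 R (F : (Fin 1 → E4) → ℂ)

/-- The Step-0 function residual in degree 1 from the tie: `W₁ ≡ κ`. [folklore] -/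
theorem residual_one_of_tie (r : LatticeRep G) (sch : SpeciesScheme (YMSpecies G)) (S₁ : SchwingerFamily E4)
    (htie : Tie r sch S₁) :
    ∃ W : (Fin 1 → E4) → ℂ, ∀ F : 𝓢((Fin 1 → E4), ℂ), IsOffDiagonal F →
      Integrable (fun x : Fin 1 → E4 => W x * F x) ∧ S₁ 1 F = ∫ x : Fin 1 → E4, W x * F x := by
  obtain ⟨κ, hκ⟩ := onePoint_of_tie r sch S₁ htie
  haveI : (volume : Measure (Fin 1 → E4)).HasTemperateGrowth := Measure.IsAddHaarMeasure.instHasTemperateGrowth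
  refine ⟨fun _ => κ, fun F _ => ⟨(F.integrable (μ := volume)).const_mul κ, ?_⟩⟩
  rw [hκ F, integral_const_mul]

/-- **The `β_k = 0`-frequently slice of scheme space is closed**: a family tied to a scheme with `β_k = 0` for
infinitely many `k` is invariant on off-diagonal real tensors of positive degree under EVERY linear isometry of `ℝ⁴`,
whatever `c_k, m_k, a_k, L_k` and the faithful `r` (`apply_linActMulti_eq_of_beta_zero`, its one-point hypothesis
discharged by `degreeOne_invariant_of_tie`). [folklore] -/
theorem tie_conclusion_on_tensors_of_beta_zero (r : LatticeRep G) (sch : SpeciesScheme (YMSpecies G))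
    (hβ : ∃ᶠ k in atTop, sch.β k = 0) {S₁ : SchwingerFamily E4} (htie : Tie r sch S₁) (R : E4 ≃ₗᵢ[ℝ] E4)
    {n : ℕ} (hn : n ≠ 0) (f : Fin n → 𝓢(E4, ℝ)) (F : 𝓢((Fin n → E4), ℂ))
    (hF : IsTensorOf F fun i => ofRealTest (f i)) (hF' : IsOffDiagonal F) :
    S₁ n (linActMulti R F) = S₁ n F :=
  apply_linActMulti_eq_of_beta_zero r sch hβ htie R (fun _ G₁ _ => degreeOne_invariant_of_tie r sch S₁ htie R G₁)
    hn f F hF hF'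

end Tied

/-- The Step-0 function residual in degree 0: `𝔖₀ F = F default` (E0), and Lebesgue measure on the one-point space
`Fin 0 → ℝ⁴` is the Dirac mass, so `W₀ ≡ 1`. [folklore] -/
theorem residual_zero (S₁ : SchwingerFamily E4) (h0 : S₁.toLabelled.IsNormalized) :
    ∃ W : (Fin 0 → E4) → ℂ, ∀ F : 𝓢((Fin 0 → E4), ℂ), IsOffDiagonal F →
      Integrable (fun x : Fin 0 → E4 => W x * F x) ∧ S₁ 0 F = ∫ x : Fin 0 → E4, W x * F x := by
  have hvol : (volume : Measure (Fin 0 → E4)) = Measure.dirac default := by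
    rw [MeasureTheory.volume_pi]
    exact Measure.pi_of_empty _ default
  refine ⟨fun _ => 1, fun F _ => ?_⟩
  simp only [one_mul]
  refine ⟨?_, ?_⟩
  · rw [hvol]
    exact (integrable_const (F default)).congr (ae_eq_dirac (F : (Fin 0 → E4) → ℂ)).symm
  · rw [hvol, integral_dirac]
    exact (h0 (fun _ => ()) F).trans (congrArg F (Subsingleton.elim _ _))

/-- The Step-0 function residual in degree 2: the radial-kernel hypothesis IS a function residual,
`W₂ x = K(x₀ − x₁)`. [folklore] -/
theorem residual_two {S₁ : SchwingerFamily E4} (hK : RadialKernel S₁) :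
    ∃ W : (Fin 2 → E4) → ℂ, ∀ F : 𝓢((Fin 2 → E4), ℂ), IsOffDiagonal F →
      Integrable (fun x : Fin 2 → E4 => W x * F x) ∧ S₁ 2 F = ∫ x : Fin 2 → E4, W x * F x := by
  obtain ⟨K, -, -, hK2⟩ := hK
  exact ⟨fun x => (K (x 0 - x 1) : ℂ), fun F hF => hK2 F hF⟩

/-- **Degrees `≤ 2` of the crux are closed unconditionally** (registered sub-goal `cruxDegreesLeTwo` of
stmt-QuantumFields-11686): for a family tied to the curvature channel of Wilson's lattice theory along a scheme and
carrying the radial two-point kernel, `𝔖₀, 𝔖₁, 𝔖₂` are invariant on `⁰𝒮` under EVERY linear isometry of `ℝ⁴` —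
degree 0 trivially (`Fin 0 → ℝ⁴` is a point), degree 1 through the tie (`degreeOne_invariant_of_tie`), degree 2 by
the radial kernel (`radialKernel_invariant_two`). [folklore] -/
theorem cruxDegreesLeTwo :
    ∀ (G : Type) [Group G] [TopologicalSpace G] [IsTopologicalGroup G] [CompactSpace G] [MeasurableSpace G] [BorelSpace G] (r : Literature.MathematicalPhysics.QuantumFieldTheory.LatticeRep G) (sch : Literature.MathematicalPhysics.QuantumFieldTheory.SpeciesScheme (Literature.MathematicalPhysics.QuantumFieldTheory.YMSpecies G)) (S₁ : Literature.MathematicalPhysics.QuantumLattice.SchwingerFamily (EuclideanSpace ℝ (Fin 4))), Summit.QuantumFields.YangMills.Theorems.CurvatureBoostCovariance.Negative.Tie r sch S₁ → Summit.QuantumFields.YangMills.Theorems.NPointIsotropy.Negative.RadialKernel S₁ → ∀ (R : EuclideanSpace ℝ (Fin 4) ≃ₗᵢ[ℝ] EuclideanSpace ℝ (Fin 4)) (n : ℕ), n ≤ 2 → ∀ F : SchwartzMap (Fin n → EuclideanSpace ℝ (Fin 4)) ℂ, Literature.MathematicalPhysics.AQFT.IsOffDiagonal F → S₁ n (Literature.MathematicalPhysics.QuantumLattice.linActMulti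 R F) = S₁ n F := by
  intro G _ _ _ _ _ _ r sch S₁ htie hK R n hn F hF
  interval_cases n
  · rw [DegreeLeTwo.linActMulti_fin_zero]
  · exact degreeOne_invariant_of_tie r sch S₁ htie R F
  · exact radialKernel_invariant_two hK R F hF

end Summit.QuantumFields.YangMills.Theorems.NPointIsotropy.ComplexRotationBandlimit

end
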